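/-
Copyright: the b2b-balaban cell (near-miss cell 7), T⁴-continuum fan-out; row NE7b ROUND-2 swarm, seat
t4-ne7b-formalise-leaf-10 (gen 3; sub-row S6g′(f) of `t4/b2b-balaban-t4-ne7b-p1/LEAVES-NE7b.md`, owner's ruling
R-OWNER-22-12 (2); sequel of `HistorySiblingEntropy` (e) and of this lineage's finding F-leaf10-3).
Released under the licence of the surrounding project.
-/
import Summits.QuantumFields.BalabanUV.T4Continuum.Support.HistorySiblingEntropyJoins

/-!
# Sibling entropy bound, part 3: the KRAFT SUM and the BOUND — the sibling entropy of a canonically ordered shape tree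
# is at most `2·Φ` (row S6g′(f))

Summits-side support leaf of the T⁴-continuum cell (rung (B)+1 on a FINITE torus only; NOT infinite volume, NOT the
mass gap, NOT the Clay statement; NOT a proof of the spine estimate NE7b).  Row NE7b, route «COUNT», row S6g′
«MASS-BASED SIBLING COUNT» (R-OWNER-22-12 (2)); sequel of parts 1–2 (`HistorySiblingEntropyShapes`∕`…Joins`) and of
`HistorySiblingEntropy` (e).  [folklore] finite combinatorics and real arithmetic over an ABSTRACT shape type; nothing
is quoted from print, nothing printed is asserted, no `[cite:]` tag, no `Prop` fact minted; constants absolute.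

THE ARGUMENT.  Put `G := C·Φ − ent`.  (1) KRAFT (`kraft`): over any finite set of DISTINCT well-formed canonical shapes
with root step `r` and last event `≤ t`, `Σ e^{−G} ≤ 4e^{−C}·e^{t−r}`, by induction on the node count: atoms give
`≤ 2e^{−C}`; the joins with top step `s` give (hosts, `≤ 4e^{−C}e^{s−1−r}` by induction) × `2V` with
`V ≤ 8e^{−4C}` (part 2), and `Σ_{s ≤ t} e^{s−1−r} ≤ e^{t−r}`.  (2) GIBBS (`logMultinomial_le_energy`, the form of
`HistorySiblingEntropy`'s Gibbs inequality used here, re-derived from (d′)'s `class_cost_le`) at each join of the GIVEN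
tree with energies `E_x = G x + C(age_x + 1) ≥ 0` (induction) and partition function `≤ 8e^{−4C} ≤ e^{−3}` (Kraft):
`log(K!∕∏k!) ≤ Σ_{non-host x} (G x + C(age_x + 1))`; unrolled along the host chain this closes **`ent ≤ C·Φ`** with the
SAME `C` — a non-host part's internal entropy is paid by its own `Φ` exactly once (only hosts are recursed into), so
there is no nesting double-charge (the defect of the rank road, F-leaf10-3 §2(iii)), and the exponential growth of the
Kraft sum in the span is harmless because a non-host part's span is below its AGE, which is paid.

WHAT.  §3 (end) **`kraft`**.  §4 `Parts.phi_cast`, `eight_mul_exp_le`, **`logMultinomial_le_energy`**, **`ent_le_mul_phi`**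
(`2 ≤ C → WF g → Canon g → ent g ≤ C·phi g`), `ent_le`, **`ent_le_two_mul_phi`**.  §5 sanity (a decided `Φ`, a `WF`, the
one-join entropy).

HONEST SCOPE.  An abstract theorem about OUR bookkeeping; its USE needs the bridge «sub-structure of a tagged genealogy
with its cluster parts (`HistoryJoins.jparts`) ↦ `Shape`» identifying leaf-05's classes (`HistoryJoinsAdm.key`: equal
ORDERED sub-structures) with equal shapes, which holds iff the ENCODING CONVENTION «each cluster lists its non-host parts
in a canonical shape-first order» is adopted — the owner's to rule (journal l.9428).  Nothing of print is asserted;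
nothing of H3∕(B)∕BetaPertH is touched.  NE7b NOT proved.  HONEST DEPENDENCY (cell): continuum YM on T⁴ ⇐ BetaPertH ∧
nine spine estimates (0/9 proved); BetaPertH ⇐ (D1) ∧ (D4) ∧ CAP+tail; G-an2-4 gates asym, D1 and NE2/3/4.  This file
changes none of it.
-/

open Finset

namespace Summit.QuantumFields.BalabanUV.T4Continuum.HistorySiblingEntropyBound

open Summit.QuantumFields.BalabanUV.T4Continuum.HistorySiblingEntropy
open Summit.QuantumFields.BalabanUV.T4Continuum.HistorySiblingMass (class_cost_le)

noncomputable section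

/-! ## §3 (end) The Kraft sum -/

/-- **THE KRAFT SUM.**  For `C ≥ 2`: over any finite set of DISTINCT well-formed canonical shapes with root step `r`
and last event `≤ t` (and at most `N` nodes — any `N`), `Σ e^{−(C·Φ − ent)} ≤ 4e^{−C}·e^{t − r}`. [folklore] -/
theorem kraft {C : ℝ} (hC : 2 ≤ C) : ∀ (N r t : ℕ) (𝒢 : Finset Shape),
    (∀ g ∈ 𝒢, g.WF ∧ g.Canon ∧ g.nodes ≤ N ∧ g.root = r ∧ g.last ≤ t) →
    ∑ g ∈ 𝒢, Real.exp (-G C g) ≤ 4 * Real.exp (-C) * Real.exp ((t : ℝ) - r) := by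
  intro N
  induction N with
  | zero =>
      intro r t 𝒢 h𝒢
      have : 𝒢 = ∅ := eq_empty_of_forall_notMem fun g hg => by
        have h1 := (h𝒢 g hg).2.2.1; have h2 := g.one_le_nodes; omega
      rw [this, sum_empty]; positivity
  | succ N ih =>
      intro r t 𝒢 h𝒢
      classical
      set B := 4 * Real.exp (-C) with hBdef
      have hB0 : 0 ≤ B := by positivity
      have hV1 : 2 * B * Real.exp (-(3 * C)) ≤ 1 / 2 := by
        have h4 := exp_neg_four_mul_le hC
        have : 2 * B * Real.exp (-(3 * C)) = 8 * Real.exp (-(4 * C)) := by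
          rw [hBdef, show -(4 * C) = -C + -(3 * C) by ring, Real.exp_add]; ring
        rw [this]; linarith
      -- empty family
      rcases 𝒢.eq_empty_or_nonempty with h0 | hne
      · rw [h0, sum_empty]; positivity
      obtain ⟨g₀, hg₀⟩ := hne
      have hrt : r ≤ t := by
        obtain ⟨hw, -, -, hr, hl⟩ := h𝒢 g₀ hg₀
        have := Shape.root_le_last hw; omega
      have hexp1 : 1 ≤ Real.exp ((t : ℝ) - r) := Real.one_le_exp (sub_nonneg.2 (by exact_mod_cast hrt))
      -- atoms / joins
      rw [← sum_filter_add_sum_filter_not 𝒢 (fun g => g.isAtom = true)]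
      have hA : ∑ g ∈ 𝒢.filter (fun g => g.isAtom = true), Real.exp (-G C g) ≤ 2 * Real.exp (-C) :=
        atoms_le (by linarith) _ fun g hg => by
          rw [mem_filter] at hg; exact ⟨hg.2, (h𝒢 g hg.1).2.2.2.1⟩
      set J := 𝒢.filter (fun g => ¬ g.isAtom = true) with hJdef
      have hJ : ∀ g ∈ J, g.isAtom = false ∧ g.WF ∧ g.Canon ∧ g.nodes ≤ N + 1 ∧ g.root = r ∧ g.last ≤ t := by
        intro g hg
        rw [mem_filter] at hg
        exact ⟨by simpa using hg.2, h𝒢 g hg.1⟩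
      -- the joins, one top step at a time
      have hstep : ∀ s ∈ J.image Shape.last,
          ∑ g ∈ J.filter (fun g => g.last = s), Real.exp (-G C g) ≤
            B * Real.exp (((s - 1 - r : ℕ) : ℝ)) * (4 * B * Real.exp (-(3 * C))) := by
        intro s hs
        set Js := J.filter (fun g => g.last = s) with hJs
        have hJs' : ∀ g ∈ Js, g.isAtom = false ∧ g.WF ∧ g.Canon ∧ g.nodes ≤ N + 1 ∧ g.root = r ∧ g.last = s := by
          intro g hg
          rw [mem_filter] at hg
          obtain ⟨ha, hw, hc, hn, hr, -⟩ := hJ g hg.1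
          exact ⟨ha, hw, hc, hn, hr, hg.2⟩
        -- unpack a join: host and parts data
        have hdata : ∀ g ∈ Js, g.host.WF ∧ g.host.Canon ∧ g.host.nodes ≤ N ∧ g.host.root = r ∧ g.host.last < s ∧
            (∀ x ∈ g.parts.toList, x.WF ∧ x.Canon ∧ x.nodes ≤ N ∧ x.last < s) := by
          intro g hg
          obtain ⟨ha, hw, hc, hn, hr, hl⟩ := hJs' g hg
          have e := Shape.eq_join ha
          rw [e] at hw hc hn hr
          simp only [Shape.WF, Shape.Canon, Shape.nodes, Shape.root] at hw hc hn hr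
          rw [hl] at hw
          refine ⟨hw.1, hc.1, by omega, hr, hw.2.1, fun x hx => ?_⟩
          have hwx := ((Parts.wf_iff s _).1 hw.2.2.2) x hx
          have hcx := ((Parts.canon_iff _).1 hc.2.1) x hx
          have hnx : x.nodes < (Shape.join g.last g.host g.parts).nodes := Shape.nodes_lt_of_mem hx
          simp only [Shape.nodes] at hnx
          exact ⟨hwx.1, hcx, by omega, hwx.2⟩
        obtain ⟨g₁, hg₁⟩ : Js.Nonempty := by
          obtain ⟨g, hg, rfl⟩ := mem_image.1 hs
          exact ⟨g, mem_filter.2 ⟨hg, rfl⟩⟩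
        have hrs : r + 1 ≤ s := by
          obtain ⟨hw, -, -, hr, hl, -⟩ := hdata g₁ hg₁
          have := Shape.root_le_last hw; omega
        -- the parts' generating value
        have hU : ∀ x ∈ Js.biUnion (fun g => g.parts.toList.toFinset), x.WF ∧ x.Canon ∧ x.nodes ≤ N ∧ x.last < s := by
          intro x hx
          obtain ⟨g, hg, hx'⟩ := mem_biUnion.1 hx
          exact (hdata g hg).2.2.2.2.2 x (List.mem_toFinset.1 hx')
        have hV := parts_value_le hC hB0 _ hU fun ρ T hT => by
          have := ih ρ (s - 1) T hT; rw [hBdef]; exact this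
        -- the joins of step `s` against their hosts
        have h1 := joins_step_le C Js (fun g hg => by
          obtain ⟨ha, hw, hc, -, -, hl⟩ := hJs' g hg; exact ⟨ha, hw, hc, hl⟩)
          (by positivity) hV1 hV
        -- the hosts
        have hH : ∑ h ∈ Js.image Shape.host, Real.exp (-G C h) ≤ B * Real.exp (((s - 1 : ℕ) : ℝ) - r) := by
          have := ih r (s - 1) (Js.image Shape.host) fun h hh => by
            obtain ⟨g, hg, rfl⟩ := mem_image.1 hh
            obtain ⟨hw, hc, hn, hr, hl, -⟩ := hdata g hg
            exact ⟨hw, hc, hn, hr, by omega⟩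
          rw [hBdef]; exact this
        have hcast : Real.exp (((s - 1 : ℕ) : ℝ) - r) = Real.exp (((s - 1 - r : ℕ) : ℝ)) := by
          rw [Nat.cast_sub (show r ≤ s - 1 by omega)]
        rw [hcast] at hH
        have hV0 : 0 ≤ 2 * (2 * B * Real.exp (-(3 * C))) := by positivity
        calc ∑ g ∈ Js, Real.exp (-G C g)
            ≤ (∑ h ∈ Js.image Shape.host, Real.exp (-G C h)) * (2 * (2 * B * Real.exp (-(3 * C)))) := h1
          _ ≤ B * Real.exp (((s - 1 - r : ℕ) : ℝ)) * (2 * (2 * B * Real.exp (-(3 * C)))) :=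
              mul_le_mul_of_nonneg_right hH hV0
          _ = B * Real.exp (((s - 1 - r : ℕ) : ℝ)) * (4 * B * Real.exp (-(3 * C))) := by ring
      -- sum over the top steps `s ∈ (r, t]`
      have hJsum : ∑ g ∈ J, Real.exp (-G C g) ≤ B * (4 * B * Real.exp (-(3 * C))) * Real.exp ((t : ℝ) - r) := by
        rw [← sum_fiberwise_of_maps_to (g := Shape.last) (t := J.image Shape.last) fun g hg => mem_image_of_mem _ hg]
        have hinj : Set.InjOn (fun s => s - 1 - r) (J.image Shape.last : Set ℕ) := by
          intro a ha b hb h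
          obtain ⟨ga, hga, rfl⟩ := mem_image.1 ha
          obtain ⟨gb, hgb, rfl⟩ := mem_image.1 hb
          obtain ⟨haa, hwa, -, -, hra, -⟩ := hJ ga hga
          obtain ⟨hab, hwb, -, -, hrb, -⟩ := hJ gb hgb
          have ea := Shape.eq_join haa; have eb := Shape.eq_join hab
          rw [ea] at hwa hra; rw [eb] at hwb hrb
          simp only [Shape.WF, Shape.root] at hwa hra hwb hrb
          have := Shape.root_le_last hwa.1; have := Shape.root_le_last hwb.1
          simp only at h; omega
        have hlt : ∀ j ∈ (J.image Shape.last).image (fun s => s - 1 - r), j < t - r := by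
          intro j hj
          obtain ⟨s, hs, rfl⟩ := mem_image.1 hj
          obtain ⟨g, hg, rfl⟩ := mem_image.1 hs
          obtain ⟨ha, hw, -, -, hr, hl⟩ := hJ g hg
          have e := Shape.eq_join ha
          rw [e] at hw hr
          simp only [Shape.WF, Shape.root] at hw hr
          have := Shape.root_le_last hw.1
          omega
        have hsum := sum_exp_le_exp _ hlt
        rw [sum_image hinj] at hsum
        have htr : ((t - r : ℕ) : ℝ) = (t : ℝ) - r := by rw [Nat.cast_sub hrt]
        rw [htr] at hsum
        calc ∑ s ∈ J.image Shape.last, ∑ g ∈ J.filter (fun g => g.last = s), Real.exp (-G C g)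
            ≤ ∑ s ∈ J.image Shape.last, B * Real.exp (((s - 1 - r : ℕ) : ℝ)) * (4 * B * Real.exp (-(3 * C))) :=
              sum_le_sum hstep
          _ = B * (4 * B * Real.exp (-(3 * C))) * ∑ s ∈ J.image Shape.last, Real.exp (((s - 1 - r : ℕ) : ℝ)) := by
              rw [mul_sum]; exact sum_congr rfl fun s _ => by ring
          _ ≤ B * (4 * B * Real.exp (-(3 * C))) * Real.exp ((t : ℝ) - r) :=
              mul_le_mul_of_nonneg_left hsum (by positivity)
      -- assemble: 2e^{−C} + 4B²e^{−3C}·e^{t−r} ≤ B·e^{t−r}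
      have hnum : B * (4 * B * Real.exp (-(3 * C))) ≤ 2 * Real.exp (-C) := by
        have h4 := exp_neg_four_mul_le hC
        have : B * (4 * B * Real.exp (-(3 * C))) = 64 * Real.exp (-(4 * C)) * Real.exp (-C) := by
          rw [hBdef, show -(4 * C) = -C + -(3 * C) by ring, Real.exp_add]; ring
        rw [this]
        have hC0 : 0 ≤ Real.exp (-C) := (Real.exp_pos _).le
        nlinarith
      have hC0 : 0 ≤ Real.exp (-C) := (Real.exp_pos _).le
      calc ∑ g ∈ 𝒢.filter (fun g => g.isAtom = true), Real.exp (-G C g) + ∑ g ∈ J, Real.exp (-G C g)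
          ≤ 2 * Real.exp (-C) + B * (4 * B * Real.exp (-(3 * C))) * Real.exp ((t : ℝ) - r) := add_le_add hA hJsum
        _ ≤ 2 * Real.exp (-C) * Real.exp ((t : ℝ) - r) + 2 * Real.exp (-C) * Real.exp ((t : ℝ) - r) := by
            have hE0 : 0 ≤ Real.exp ((t : ℝ) - r) := (Real.exp_pos _).le
            nlinarith [mul_le_mul_of_nonneg_right hnum hE0]
        _ = B * Real.exp ((t : ℝ) - r) := by rw [hBdef]; ring


/-! ## §4 The bound -/

/-- `Parts.phi` cast to `ℝ`, as a sum over the list [folklore] -/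
theorem Parts.phi_cast (s : ℕ) : ∀ ps : Parts,
    ((ps.phi s : ℕ) : ℝ) = (ps.toList.map fun x => (x.phi : ℝ) + ((s + 1 - x.root : ℕ) : ℝ) + 1).sum
  | .nil => by simp [Parts.phi, Parts.toList]
  | .cons x ps => by
      rw [Parts.phi, Parts.toList, List.map_cons, List.sum_cons, ← Parts.phi_cast s ps]; push_cast; ring

/-- `8·e^{−4C} ≤ e^{−3}` for `C ≥ 2` (from `e ≤ 3`) [folklore] -/
theorem eight_mul_exp_le {C : ℝ} (hC : 2 ≤ C) : 8 * Real.exp (-(4 * C)) ≤ Real.exp (-3) := by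
  have h4 := exp_neg_four_mul_le hC
  have he : Real.exp 1 ≤ 3 := by have := Real.exp_one_lt_d9; norm_num at this; linarith
  have h3 : (1 / 27 : ℝ) ≤ Real.exp (-3) := by
    have : Real.exp (-3) = (Real.exp 1 ^ 3)⁻¹ := by
      rw [← Real.exp_nat_mul, ← Real.exp_neg]; norm_num
    rw [this, one_div, inv_le_inv₀ (by norm_num) (by positivity)]
    calc Real.exp 1 ^ 3 ≤ 3 ^ 3 := pow_le_pow_left₀ (Real.exp_pos _).le he 3
      _ = 27 := by norm_num
  linarith

/-- **GIBBS, IN THE FORM USED** (self-contained twin of `HistorySiblingEntropy`'s Gibbs form): classes `g ∈ Gs` with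
sizes `k g` and energies `E g ≥ 0` whose partition function is small, `Σ_g e^{−E g} ≤ e^{−3}`, have
`logMultinomial Gs k ≤ Σ_g k_g·E_g`.  ((d′)'s `class_cost_le` at rate `1` against the mass `Z := K ∕ Σ e^{−E}`, the exact
split `classes_cost_eq`, `log K! ≤ K·log K`.) [folklore] -/
theorem logMultinomial_le_energy {β : Type*} {Gs : Finset β} (hne : Gs.Nonempty) (k : β → ℕ) (E : β → ℝ)
    (hE : ∀ g ∈ Gs, 0 ≤ E g) (hZ : ∑ g ∈ Gs, Real.exp (-E g) ≤ Real.exp (-3)) :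
    logMultinomial Gs k ≤ ∑ g ∈ Gs, (k g : ℝ) * E g := by
  set K : ℕ := ∑ g ∈ Gs, k g with hK
  set W : ℝ := ∑ g ∈ Gs, Real.exp (-E g) with hW
  have hKcast : (K : ℝ) = ∑ g ∈ Gs, (k g : ℝ) := by rw [hK]; push_cast; rfl
  have hW0 : 0 < W := sum_pos (fun g _ => Real.exp_pos _) hne
  have hlogW : Real.log W ≤ -3 := by
    have := Real.log_le_log hW0 hZ; rwa [Real.log_exp] at this
  rcases Nat.eq_zero_or_pos K with hK0 | hKpos
  · have hk0 : ∀ g ∈ Gs, k g = 0 := fun g hg => by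
      have := single_le_sum (f := k) (fun g _ => Nat.zero_le (k g)) hg
      rw [← hK, hK0] at this
      exact Nat.le_zero.1 this
    have hL : logMultinomial Gs k = 0 := by
      unfold logMultinomial
      rw [← hK, hK0, sum_congr rfl fun g hg => by rw [hk0 g hg]]
      simp
    have hs : ∑ g ∈ Gs, (k g : ℝ) * E g = 0 := sum_eq_zero fun g hg => by rw [hk0 g hg]; simp
    rw [hL, hs]
  · have hKr : (0 : ℝ) < K := by exact_mod_cast hKpos
    set Z : ℝ := (K : ℝ) / W with hZdef
    have hZ0 : 0 ≤ Z := div_nonneg hKr.le hW0.le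
    have hsplit := classes_cost_eq Gs k Z
    -- per class: `class_cost_le` at rate one with `r := E g`
    have henergy : ∑ g ∈ Gs, ((k g : ℝ) * Real.log Z - Real.log ((k g).factorial : ℝ)) ≤
        2 * ∑ g ∈ Gs, (k g : ℝ) + ∑ g ∈ Gs, (k g : ℝ) * E g + Z * W := by
      have h1 : ∀ g ∈ Gs, (k g : ℝ) * Real.log Z - Real.log ((k g).factorial : ℝ) ≤
          2 * (k g : ℝ) + (k g : ℝ) * E g + Z * Real.exp (-E g) := by
        intro g hg
        rcases Nat.eq_zero_or_pos (k g) with h0 | hpos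
        · rw [h0]; simp only [Nat.cast_zero, zero_mul, Nat.factorial_zero, Nat.cast_one, Real.log_one, sub_zero,
            mul_zero, add_zero, zero_add]
          exact mul_nonneg hZ0 (Real.exp_pos _).le
        · have h := class_cost_le (k := k g) hpos hZ0 (c := 1) (r := E g) zero_le_one (hE g hg)
          simp only [one_mul] at h
          linarith
      calc ∑ g ∈ Gs, ((k g : ℝ) * Real.log Z - Real.log ((k g).factorial : ℝ))
          ≤ ∑ g ∈ Gs, (2 * (k g : ℝ) + (k g : ℝ) * E g + Z * Real.exp (-E g)) := sum_le_sum h1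
        _ = 2 * ∑ g ∈ Gs, (k g : ℝ) + ∑ g ∈ Gs, (k g : ℝ) * E g + Z * W := by
            rw [hW, mul_sum, mul_sum, ← sum_add_distrib, ← sum_add_distrib]
    have hZW : Z * W = K := div_mul_cancel₀ (K : ℝ) hW0.ne'
    have hlogZ : Real.log Z = Real.log K - Real.log W := Real.log_div hKr.ne' hW0.ne'
    have hfact := log_factorial_le_mul_log K
    rw [← hK] at hsplit
    rw [hZW, ← hKcast] at henergy
    have hKZ : (K : ℝ) * Real.log Z = (K : ℝ) * Real.log K - (K : ℝ) * Real.log W := by rw [hlogZ]; ring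
    have hKW : (K : ℝ) * Real.log W ≤ (K : ℝ) * (-3) := mul_le_mul_of_nonneg_left hlogW hKr.le
    linarith [hsplit, henergy, hfact, hKZ, hKW]

/-- **THE SIBLING ENTROPY OF A CANONICAL SHAPE TREE IS CLASS-LINEAR**: for `C ≥ 2` and every well-formed canonical shape,
`ent ≤ C·Φ` — i.e. `Σ_joins log(K!∕∏_g k_g!) ≤ C·Σ_births (1 + fat) + C·Σ_joins Σ_{non-host parts} (age + 1)`. [folklore] -/
theorem ent_le_mul_phi {C : ℝ} (hC : 2 ≤ C) : ∀ (N : ℕ) (g : Shape), g.nodes ≤ N → g.WF → g.Canon →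
    g.ent ≤ C * g.phi := by
  intro N
  induction N with
  | zero => intro g hn; have := g.one_le_nodes; omega
  | succ N ih =>
      intro g hn hw hc
      cases g with
      | atom r f =>
          simp only [Shape.ent, Shape.phi]
          have : (0 : ℝ) ≤ ((1 + f : ℕ) : ℝ) := Nat.cast_nonneg _
          nlinarith
      | join s h ps =>
          classical
          simp only [Shape.WF] at hw
          simp only [Shape.Canon] at hc
          simp only [Shape.nodes] at hn
          obtain ⟨hwh, hls, hne, hwps⟩ := hw
          obtain ⟨hch, hcps, -⟩ := hc
          have hparts : ∀ x ∈ ps.toList, x.WF ∧ x.Canon ∧ x.nodes ≤ N ∧ x.last < s := by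
            intro x hx
            have hwx := ((Parts.wf_iff s ps).1 hwps) x hx
            have hcx := ((Parts.canon_iff ps).1 hcps) x hx
            have hnx := Shape.nodes_lt_of_mem (s := s) (h := h) hx
            simp only [Shape.nodes] at hnx
            exact ⟨hwx.1, hcx, by omega, hwx.2⟩
          have hh : h.ent ≤ C * h.phi := ih h (by omega) hwh hch
          -- the data of the Gibbs step
          set T := ps.toList with hT
          set Gs := T.toFinset with hGs
          set k : Shape → ℕ := fun x => T.count x with hk
          set E : Shape → ℝ := fun x => G C x + C * (((s + 1 - x.root : ℕ) : ℝ) + 1) with hE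
          have hC0 : 0 ≤ C := by linarith
          have hE0 : ∀ x ∈ Gs, 0 ≤ E x := by
            intro x hx
            have hx' : x ∈ T := List.mem_toFinset.1 hx
            obtain ⟨hwx, hcx, hnx, -⟩ := hparts x hx'
            have := ih x hnx hwx hcx
            simp only [hE, G]
            have : (0 : ℝ) ≤ ((s + 1 - x.root : ℕ) : ℝ) + 1 := by positivity
            nlinarith
          have hGne : Gs.Nonempty := by
            rw [hGs, List.toFinset_nonempty_iff]
            exact Parts.toList_ne_nil hne
          -- the partition function of the present classes
          have hZ : ∑ x ∈ Gs, Real.exp (-E x) ≤ Real.exp (-3) := by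
            have hU : ∀ x ∈ Gs, x.WF ∧ x.Canon ∧ x.nodes ≤ N ∧ x.last < s := fun x hx =>
              hparts x (List.mem_toFinset.1 hx)
            have h1 := parts_value_le hC (B := 4 * Real.exp (-C)) (by positivity) (N := N) (s := s) Gs hU
              fun ρ U hU' => kraft hC N ρ (s - 1) U hU'
            have h2 : ∑ x ∈ Gs, Real.exp (-E x) = ∑ x ∈ Gs, wt C s x := sum_congr rfl fun x _ => by
              simp only [wt, hE]
            rw [h2]
            calc ∑ x ∈ Gs, wt C s x ≤ 2 * (4 * Real.exp (-C)) * Real.exp (-(3 * C)) := h1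
              _ = 8 * Real.exp (-(4 * C)) := by
                  rw [show -(4 * C) = -C + -(3 * C) by ring, Real.exp_add]; ring
              _ ≤ Real.exp (-3) := eight_mul_exp_le hC
          have hlm : ps.lmult ≤ ∑ x ∈ Gs, (k x : ℝ) * E x := logMultinomial_le_energy hGne k E hE0 hZ
          -- list sums as count-weighted sums over `Gs`
          have hsub : T.toFinset ⊆ Gs := by rw [hGs]
          have e1 : (T.map Shape.ent).sum = ∑ x ∈ Gs, (k x : ℝ) * x.ent := list_sum_eq_sum_count hsub _
          have e2 : ((ps.phi s : ℕ) : ℝ) = ∑ x ∈ Gs, (k x : ℝ) * ((x.phi : ℝ) + ((s + 1 - x.root : ℕ) : ℝ) + 1) := by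
            rw [Parts.phi_cast, ← hT]; exact list_sum_eq_sum_count hsub _
          have e3 : ∑ x ∈ Gs, (k x : ℝ) * E x + ∑ x ∈ Gs, (k x : ℝ) * x.ent =
              C * ∑ x ∈ Gs, (k x : ℝ) * ((x.phi : ℝ) + ((s + 1 - x.root : ℕ) : ℝ) + 1) := by
            rw [← sum_add_distrib, mul_sum]
            refine sum_congr rfl fun x _ => ?_
            simp only [hE, G]; ring
          -- assemble
          simp only [Shape.ent, Shape.phi, Nat.cast_add]
          rw [Parts.entSum_eq_sum, ← hT, e1, e2]
          nlinarith [hlm, e3, hh]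


/-- **THE BOUND, NODE COUNT ELIMINATED**: `ent g ≤ C·Φ g` for every well-formed canonical shape, `C ≥ 2`. [folklore] -/
theorem ent_le (g : Shape) (hw : g.WF) (hc : g.Canon) {C : ℝ} (hC : 2 ≤ C) : g.ent ≤ C * g.phi :=
  ent_le_mul_phi hC g.nodes g le_rfl hw hc

/-- **THE HEADLINE CONSTANT**: the sibling entropy of a well-formed canonical shape tree is at most TWICE its budget
`Φ = Σ_births (1 + fat) + Σ_joins Σ_{non-host parts} (age + 1)` (natural logarithms). [folklore] -/
theorem ent_le_two_mul_phi (g : Shape) (hw : g.WF) (hc : g.Canon) : g.ent ≤ 2 * g.phi :=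
  ent_le g hw hc le_rfl

end

/-! ## §5 Sanity -/

namespace Sanity

/-- a host born at step `0` joined at step `3` by two EQUAL parts (births of step `1`, fatness `0`) and one different part
(fatness `4`): `Φ = (1+0) + [(1+0)+3+1]·2 + [(1+4)+3+1] = 20` -/
example : (Shape.join 3 (.atom 0 0) (.cons (.atom 1 0) (.cons (.atom 1 0) (.cons (.atom 1 4) .nil)))).phi = 20 := by
  decide

/-- … it is well formed … -/
example : (Shape.join 3 (.atom 0 0) (.cons (.atom 1 0) (.cons (.atom 1 0) (.cons (.atom 1 4) .nil)))).WF := by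
  simp [Shape.WF, Parts.WF, Shape.last]

/-- … and its entropy is the one join's log-multinomial `log (3!∕(2!·1!)) = log 3`, within the bound `2·Φ = 40` -/
example : (Shape.join 3 (.atom 0 0) (.cons (.atom 1 0) (.cons (.atom 1 0) (.cons (.atom 1 4) .nil)))).ent =
    Parts.lmult (.cons (.atom 1 0) (.cons (.atom 1 0) (.cons (.atom 1 4) .nil))) := by
  simp [Shape.ent, Parts.entSum]

end Sanity

end Summit.QuantumFields.BalabanUV.T4Continuum.HistorySiblingEntropyBound
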